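import Summits.Parity.BatemanHorn.Theorems.AlmostPrimeZerosSystemLSDRealSegmentNairClassOne
import HarnessLib

/-!
# Nair–Tenenbaum light, IXa: class IV preparations (series term, scales, pointwise facts)

Crux `SystemLSDRealSegment` (stmt-Parity-11292, route `AlmostPrimeZeros`), line `beta-thinned-root-kernel`,
support programme of the lead c8: **Nair–Tenenbaum "light"** — the sharp-order upper bound
`Σ_{1≤n≤N} G(F(n)) ≤ C · N · exp(Σ_{p≤N} (G(p) − 1) ρ_F(p)/p)` for a polynomial `F ∈ ℤ[X]` (degree `≥ 1`, positive on
`ℕ_{≥1}`, root counts `ρ_F(p) ≤ D`, `ρ_F(p) < p`, `ρ_F(p^a) ≤ M`) and every weight `G ≥ 0`, `G(1) = 1`, multiplicative on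
coprime arguments with `G(p^v) ≤ A` (M. Nair, Acta Arith. 62 (1992); Nair–Tenenbaum, Acta Math. 180 (1998), Thm 1 —
the special case of the class bounded at prime powers), by Shiu's method (J. reine angew. Math. 313 (1980), §5) run on the
values `m = F(n)`: cut `m = c·d` at `√N` (`Shiu.cutPrime/cPart/dPart`), four classes, the beta upper-bound sieve of dimension
`2D` on the root classes of `c`, Hall–Tenenbaum's Theorem 01 and Rankin's trick with a uniform exponent for the `c`-sums.
Applied (file `…NairUpperBound`) to the product polynomial of a Bateman–Horn system with `G = y^{capped}` it gives
`Σ_{n≤x} y^{s_f(n)} ≪ x (log x)^{k(y−1)}`, i.e. `H_x(y) = O(1)` on the real segment — the upper half of the order of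
magnitude predicted by the crux (lower half: `sumPowStat_lower_bound`, landed).  Everything here is PROVED; no definitions.

This file: `pow_mul_exp_neg_le`, the scales `v_r = z₀^{1/r}`, `w_r = z₀^{1/(r+1)}`, `η_r = c′r/log z₀` (`class4_rfacts`), and the pointwise facts of class IV (`class4_pointwise`: `r(n) ∈ [1,R]`, weight `≤ A^{(r+1)B₂}G(c)`, sifted-set and `c`-range membership).
-/

open Finset Real Polynomial

namespace Summit.Parity.BatemanHorn.Cruxes.SystemLSDRealSegment.BetaThinnedRootKernel.Nair

open Literature.NumberTheory.Sieve

noncomputable section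

section Main

variable {F : ℤ[X]} {D M : ℕ} {A : ℝ}

/-- `(r+1)^D e^{−r} ≤ (2D)^D e^{1/2} e^{−r/2}` for `D ≥ 1`. [folklore] -/
theorem pow_mul_exp_neg_le {D : ℕ} (hD1 : 1 ≤ D) (r : ℕ) :
    ((r : ℝ) + 1) ^ D * Real.exp (-(r : ℝ)) ≤ (2 * (D : ℝ)) ^ D * Real.exp (1 / 2) * Real.exp (-((r : ℝ) / 2)) := by
  have hD0 : (0 : ℝ) < D := by exact_mod_cast hD1
  set x : ℝ := (r : ℝ) + 1 with hx
  have hx0 : 0 ≤ x := by positivity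
  -- `x/(2D) ≤ exp(x/(2D))`, hence `x^D ≤ (2D)^D exp(x/2)`
  have h1 : x / (2 * D) ≤ Real.exp (x / (2 * D)) := by
    have := Real.add_one_le_exp (x / (2 * D)); linarith
  have h2 : x ^ D ≤ (2 * (D : ℝ)) ^ D * Real.exp (x / 2) := by
    have h3 : (x / (2 * D)) ^ D ≤ Real.exp (x / (2 * D)) ^ D := pow_le_pow_left₀ (by positivity) h1 D
    rw [div_pow, div_le_iff₀ (by positivity), ← Real.exp_nat_mul] at h3
    calc x ^ D ≤ Real.exp (D * (x / (2 * D))) * (2 * (D : ℝ)) ^ D := h3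
      _ = (2 * (D : ℝ)) ^ D * Real.exp (x / 2) := by rw [mul_comm]; congr 2; field_simp
  calc x ^ D * Real.exp (-(r : ℝ)) ≤ (2 * (D : ℝ)) ^ D * Real.exp (x / 2) * Real.exp (-(r : ℝ)) :=
        mul_le_mul_of_nonneg_right h2 (Real.exp_nonneg _)
    _ = (2 * (D : ℝ)) ^ D * Real.exp (1 / 2) * Real.exp (-((r : ℝ) / 2)) := by
        rw [mul_assoc, mul_assoc, ← Real.exp_add, ← Real.exp_add, hx]; ring_nf

/-- **The scales of class IV.** For `z₀ ≥ 4`, `logL ≥ 2`, `c′ > 0` with `3c′ ≤ logL` and `1 ≤ r ≤ ⌊log z₀/logL⌋`: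
`w_r = z₀^{1/(r+1)} ≥ 2`, `w_r ≤ v_r = z₀^{1/r} ≤ z₀`, `log w_r = log z₀/(r+1)`, `log v_r = log z₀/r`,
`0 < η_r = c′r/log z₀ ≤ 1/3`, `r ≤ log z₀/logL`. [folklore] -/
theorem class4_rfacts {z₀ logL c' : ℝ} (hz₀4 : (4 : ℝ) ≤ z₀) (hlogL2 : 2 ≤ logL) (hc'0 : 0 < c')
    (hlogL3c : 3 * c' ≤ logL) {r : ℕ} (hr1 : 1 ≤ r) (hrR : r ≤ ⌊Real.log z₀ / logL⌋₊) :
    2 ≤ z₀ ^ (1 / ((r : ℝ) + 1)) ∧ z₀ ^ (1 / ((r : ℝ) + 1)) ≤ z₀ ^ (1 / (r : ℝ)) ∧ z₀ ^ (1 / (r : ℝ)) ≤ z₀ ∧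
      Real.log (z₀ ^ (1 / ((r : ℝ) + 1))) = Real.log z₀ / ((r : ℝ) + 1) ∧
      Real.log (z₀ ^ (1 / (r : ℝ))) = Real.log z₀ / r ∧ 0 < c' * r / Real.log z₀ ∧ c' * r / Real.log z₀ ≤ 1 / 3 ∧
      (r : ℝ) ≤ Real.log z₀ / logL := by
  have hz₀0 : 0 < z₀ := by linarith
  have hlogLpos : 0 < logL := by linarith
  have hlogz₀4 : 2 * Real.log 2 ≤ Real.log z₀ := by
    rw [← Real.log_rpow (by norm_num), show (2 : ℝ) ^ (2 : ℝ) = 4 by norm_num]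
    exact Real.log_le_log (by norm_num) hz₀4
  have hlog2 : 0 < Real.log 2 := Real.log_pos (by norm_num)
  have hlogz₀pos : 0 < Real.log z₀ := by linarith
  have hr0 : (0 : ℝ) < r := by exact_mod_cast hr1
  have hrle : (r : ℝ) ≤ Real.log z₀ / logL :=
    le_trans (by exact_mod_cast hrR) (Nat.floor_le (by positivity))
  have hlw : Real.log (z₀ ^ (1 / ((r : ℝ) + 1))) = Real.log z₀ / ((r : ℝ) + 1) := by
    rw [Real.log_rpow hz₀0]; ring
  have hlv : Real.log (z₀ ^ (1 / (r : ℝ))) = Real.log z₀ / r := by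
    rw [Real.log_rpow hz₀0]; ring
  have hwv : z₀ ^ (1 / ((r : ℝ) + 1)) ≤ z₀ ^ (1 / (r : ℝ)) :=
    Real.rpow_le_rpow_of_exponent_le (by linarith) (one_div_le_one_div_of_le hr0 (by linarith))
  have hvz : z₀ ^ (1 / (r : ℝ)) ≤ z₀ := by
    calc z₀ ^ (1 / (r : ℝ)) ≤ z₀ ^ (1 : ℝ) := by
          refine Real.rpow_le_rpow_of_exponent_le (by linarith) ?_
          rw [div_le_one hr0]; exact_mod_cast hr1
      _ = z₀ := Real.rpow_one _
  have hw2 : 2 ≤ z₀ ^ (1 / ((r : ℝ) + 1)) := by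
    have h1 : (r : ℝ) + 1 ≤ Real.log z₀ / logL + 1 := by linarith
    have h2 : Real.log 2 * ((r : ℝ) + 1) ≤ Real.log z₀ := by
      have ha : Real.log 2 / logL ≤ 1 / 2 := by
        rw [div_le_iff₀ hlogLpos]
        have := Real.log_two_lt_d9; linarith
      have hb := mul_le_mul_of_nonneg_left ha hlogz₀pos.le
      calc Real.log 2 * ((r : ℝ) + 1) ≤ Real.log 2 * (Real.log z₀ / logL + 1) :=
            mul_le_mul_of_nonneg_left h1 hlog2.le
        _ = Real.log z₀ * (Real.log 2 / logL) + Real.log 2 := by ring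
        _ ≤ Real.log z₀ * (1 / 2) + Real.log z₀ / 2 := by linarith
        _ = Real.log z₀ := by ring
    have h3 : Real.log 2 ≤ Real.log (z₀ ^ (1 / ((r : ℝ) + 1))) := by
      rw [hlw, le_div_iff₀ (by positivity)]; linarith
    exact (Real.log_le_log_iff (by norm_num) (by positivity)).1 h3
  refine ⟨hw2, hwv, hvz, hlw, hlv, by positivity, ?_, hrle⟩
  rw [div_le_iff₀ hlogz₀pos]
  calc c' * r ≤ c' * (Real.log z₀ / logL) := mul_le_mul_of_nonneg_left hrle hc'0.le
    _ = (c' / logL) * Real.log z₀ := by ring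
    _ ≤ (1 / 3) * Real.log z₀ := by
        refine mul_le_mul_of_nonneg_right ?_ hlogz₀pos.le
        rw [div_le_iff₀ hlogLpos]; linarith

/-- **Class IV, pointwise.** For `n` in the class (cut prime `P ∈ (L, z₀)`, smooth part `c > N^{1/4}`), with
`r = ⌊log z₀/log P⌋`: `1 ≤ r ≤ ⌊log z₀/logL⌋`, the weight obeys `G(m) ≤ A^{(r+1)B₂} G(c)`, `n` lies in the sifted set of `c`
at level `w_r = z₀^{1/(r+1)}`, and `c` lies in the `c`-range of slice `r` (prime factors `< v_r = z₀^{1/r}`). [folklore] -/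
theorem class4_pointwise (hpos : ∀ n : ℕ, 1 ≤ n → 0 < F.eval (n : ℤ))
    {G : ℕ → ℝ} (hG0 : ∀ n, 0 ≤ G n) (hG1 : G 1 = 1) (hGmul : ∀ m n : ℕ, m.Coprime n → G (m * n) = G m * G n)
    (hGA : ∀ p : ℕ, p.Prime → ∀ v : ℕ, 1 ≤ v → G (p ^ v) ≤ A) (hA : 1 ≤ A)
    {N : ℕ} (hN1 : 1 ≤ N) (hNH : (∑ j ∈ range (F.natDegree + 1), (F.coeff j).natAbs) * 2 ^ F.natDegree ≤ N)
    {e₀ B₂ z₀ logL L : ℝ} (he₀0 : 0 < e₀) (hz₀ : z₀ = (N : ℝ) ^ e₀) (hB₂ : B₂ = ((F.natDegree : ℝ) + 1) / e₀)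
    (hlogLeq : Real.log L = logL) (hlogLpos : 0 < logL) (hL0 : 0 < L) {n : ℕ}
    (hn : n ∈ (Icc 1 N).filter (fun n : ℕ => Real.sqrt N < (F.eval (n : ℤ)).toNat ∧
      (Shiu.cutPrime (Real.sqrt N) (F.eval (n : ℤ)).toNat : ℝ) < z₀ ∧
      (N : ℝ) ^ (1 / 4 : ℝ) < (Shiu.cPart (Real.sqrt N) (F.eval (n : ℤ)).toNat : ℝ) ∧
      L < (Shiu.cutPrime (Real.sqrt N) (F.eval (n : ℤ)).toNat : ℝ))) :
    1 ≤ ⌊Real.log z₀ / Real.log (Shiu.cutPrime (Real.sqrt N) (F.eval (n : ℤ)).toNat)⌋₊ ∧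
    ⌊Real.log z₀ / Real.log (Shiu.cutPrime (Real.sqrt N) (F.eval (n : ℤ)).toNat)⌋₊ ≤ ⌊Real.log z₀ / logL⌋₊ ∧
    G (F.eval (n : ℤ)).toNat ≤
      A ^ (((⌊Real.log z₀ / Real.log (Shiu.cutPrime (Real.sqrt N) (F.eval (n : ℤ)).toNat)⌋₊ : ℝ) + 1) * B₂) *
        G (Shiu.cPart (Real.sqrt N) (F.eval (n : ℤ)).toNat) ∧
    n ∈ (Icc 1 N).filter (fun n' : ℕ => ((Shiu.cPart (Real.sqrt N) (F.eval (n : ℤ)).toNat : ℕ) : ℤ) ∣ F.eval (n' : ℤ) ∧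
      ∀ p ∈ Nat.primesBelow ⌈z₀ ^ (1 / ((⌊Real.log z₀ / Real.log (Shiu.cutPrime (Real.sqrt N) (F.eval (n : ℤ)).toNat)⌋₊ : ℝ) + 1))⌉₊,
        ¬ p ∣ Shiu.cPart (Real.sqrt N) (F.eval (n : ℤ)).toNat → ¬ (p : ℤ) ∣ F.eval (n' : ℤ)) ∧
    Shiu.cPart (Real.sqrt N) (F.eval (n : ℤ)).toNat ∈ (Icc 1 ⌊Real.sqrt N⌋₊).filter (fun c : ℕ =>
      (N : ℝ) ^ (1 / 4 : ℝ) < (c : ℝ) ∧ ∀ p ∈ c.primeFactors,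
        (p : ℝ) < z₀ ^ (1 / (⌊Real.log z₀ / Real.log (Shiu.cutPrime (Real.sqrt N) (F.eval (n : ℤ)).toNat)⌋₊ : ℝ))) := by
  set d := F.natDegree with hddef
  set Hh : ℕ := ∑ j ∈ range (F.natDegree + 1), (F.coeff j).natAbs with hHh
  have hN0 : (0 : ℝ) < N := by exact_mod_cast hN1
  have hB₂0 : 0 ≤ B₂ := by rw [hB₂]; positivity
  have hlogz₀ : Real.log z₀ = e₀ * Real.log N := by rw [hz₀, Real.log_rpow hN0]
  rw [Finset.mem_filter, Finset.mem_Icc] at hn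
  obtain ⟨hnI, hsq, hPz, hYc, hLP⟩ := hn
  set m := (F.eval (n : ℤ)).toNat with hm
  have hmpos : 0 < F.eval (n : ℤ) := hpos n hnI.1
  obtain ⟨hm2, hZ1⟩ := two_le_of_sqrt_lt hN1 hsq
  obtain ⟨hPmem, hcZ, hZlt, hcd, hcop, hcprimes, hdprimes, hsmall⟩ := cut_facts hm2 hZ1 hsq
  set P := Shiu.cutPrime (Real.sqrt N) m with hPdef
  set c := Shiu.cPart (Real.sqrt N) m with hcdef
  have hP : P.Prime := Nat.prime_of_mem_primeFactors hPmem
  have hLP' : L < P := hLP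
  have hP0 : (0 : ℝ) < P := hL0.trans hLP'
  have hlogP : logL < Real.log P := by rw [← hlogLeq]; exact Real.log_lt_log hL0 hLP'
  have hlogPpos : 0 < Real.log P := hlogLpos.trans hlogP
  have hz₀0 : 0 < z₀ := hP0.trans hPz
  have hlogPz : Real.log P < Real.log z₀ := Real.log_lt_log hP0 hPz
  have hlogz₀pos : 0 < Real.log z₀ := hlogPpos.trans hlogPz
  set r := ⌊Real.log z₀ / Real.log P⌋₊ with hrdef
  -- the value bound `m ≤ N^{d+1}`
  have hmN : ((m : ℕ) : ℝ) ≤ (N : ℝ) ^ ((d : ℝ) + 1) := by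
    have h1 : m ≤ Hh * (N + 1) ^ d := toNat_eval_le_height hnI.2
    have h2 : Hh * (N + 1) ^ d ≤ N ^ (d + 1) := by
      calc Hh * (N + 1) ^ d ≤ Hh * (2 * N) ^ d := Nat.mul_le_mul_left _ (Nat.pow_le_pow_left (by omega) _)
        _ = Hh * 2 ^ d * N ^ d := by rw [mul_pow]; ring
        _ ≤ N * N ^ d := Nat.mul_le_mul_right _ hNH
        _ = N ^ (d + 1) := by ring
    calc ((m : ℕ) : ℝ) ≤ ((N ^ (d + 1) : ℕ) : ℝ) := by exact_mod_cast h1.trans h2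
      _ = (N : ℝ) ^ ((d : ℝ) + 1) := by rw [Nat.cast_pow, ← Real.rpow_natCast, Nat.cast_add, Nat.cast_one]
  -- `1 ≤ r ≤ R`
  have hr1 : 1 ≤ r := by
    rw [hrdef]; refine Nat.le_floor ?_
    rw [Nat.cast_one, le_div_iff₀ hlogPpos]; linarith
  have hrR : r ≤ ⌊Real.log z₀ / logL⌋₊ := by
    rw [hrdef]
    exact Nat.floor_mono (div_le_div_of_nonneg_left hlogz₀pos.le hlogLpos hlogP.le)
  have hr0 : (0 : ℝ) < r := by exact_mod_cast hr1
  -- `P ≤ v_r` and `w_r < P`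
  have hrle : (r : ℝ) ≤ Real.log z₀ / Real.log P := by rw [hrdef]; exact Nat.floor_le (by positivity)
  have hrlt : Real.log z₀ / Real.log P < (r : ℝ) + 1 := by rw [hrdef]; exact Nat.lt_floor_add_one _
  have hPv : (P : ℝ) ≤ z₀ ^ (1 / (r : ℝ)) := by
    have h1 : Real.log P ≤ Real.log z₀ / r := by
      rw [le_div_iff₀ hr0]; rw [le_div_iff₀ hlogPpos] at hrle; linarith
    have h2 : Real.log P ≤ Real.log (z₀ ^ (1 / (r : ℝ))) := by rw [Real.log_rpow hz₀0]; rw [one_div_mul_eq_div]; exact h1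
    exact (Real.log_le_log_iff hP0 (by positivity)).1 h2
  have hwP : z₀ ^ (1 / ((r : ℝ) + 1)) < P := by
    have h1 : Real.log z₀ / ((r : ℝ) + 1) < Real.log P := by
      rw [div_lt_iff₀ (by positivity)]; rw [div_lt_iff₀ hlogPpos] at hrlt; linarith
    have h2 : Real.log (z₀ ^ (1 / ((r : ℝ) + 1))) < Real.log P := by
      rw [Real.log_rpow hz₀0, one_div_mul_eq_div]; exact h1
    exact (Real.log_lt_log_iff (by positivity) hP0).1 h2
  refine ⟨hr1, hrR, ?_, ?_, ?_⟩
  · -- weight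
    have h1 := weight_cut_le hG0 hG1 hGmul hGA hA hm2 hZ1 hsq
    have hratio : Real.log m / Real.log P ≤ ((r : ℝ) + 1) * B₂ := by
      rw [div_le_iff₀ hlogPpos]
      have h2 : Real.log m ≤ ((d : ℝ) + 1) * Real.log N := by
        have hm0 : (0 : ℝ) < m := by exact_mod_cast (show 0 < m by omega)
        calc Real.log m ≤ Real.log ((N : ℝ) ^ ((d : ℝ) + 1)) := Real.log_le_log hm0 hmN
          _ = ((d : ℝ) + 1) * Real.log N := Real.log_rpow hN0 _
      have h3 : Real.log z₀ / ((r : ℝ) + 1) ≤ Real.log P := by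
        rw [div_le_iff₀ (by positivity)]; rw [div_lt_iff₀ hlogPpos] at hrlt; linarith
      calc Real.log m ≤ ((d : ℝ) + 1) * Real.log N := h2
        _ = ((r : ℝ) + 1) * B₂ * (Real.log z₀ / ((r : ℝ) + 1)) := by rw [hlogz₀, hB₂]; field_simp
        _ ≤ ((r : ℝ) + 1) * B₂ * Real.log P := mul_le_mul_of_nonneg_left h3 (by positivity)
    calc G m ≤ G c * A ^ (Real.log m / Real.log P) := h1
      _ ≤ G c * A ^ (((r : ℝ) + 1) * B₂) :=
          mul_le_mul_of_nonneg_left (Real.rpow_le_rpow_of_exponent_le hA hratio) (hG0 _)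
      _ = A ^ (((r : ℝ) + 1) * B₂) * G c := mul_comm _ _
  · -- sifted set
    simp only [Finset.mem_filter, Finset.mem_Icc]
    refine ⟨hnI, ?_, ?_⟩
    · rw [← Int.toNat_of_nonneg hmpos.le]
      exact_mod_cast Shiu.cPart_dvd (show m ≠ 0 by omega)
    · intro p hp hpc hpF
      rw [Nat.mem_primesBelow] at hp
      have hpw : (p : ℝ) < z₀ ^ (1 / ((r : ℝ) + 1)) := (Nat.lt_ceil).1 hp.1
      have hpP : p < P := by exact_mod_cast hpw.trans hwP
      have hpm : p ∣ m := by
        rw [← Int.toNat_of_nonneg hmpos.le] at hpF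
        exact_mod_cast hpF
      exact hpc (hsmall p hp.2 hpP hpm)
  · -- `c`-range
    simp only [Finset.mem_filter, Finset.mem_Icc]
    refine ⟨⟨Nat.one_le_iff_ne_zero.2 Shiu.cPart_ne_zero, Nat.le_floor hcZ⟩, hYc, fun p hp => ?_⟩
    have h1 : p < P := hcprimes p hp
    have h2 : (p : ℝ) < P := by exact_mod_cast h1
    exact h2.trans_le hPv

end Main

/-- **Registered form** (`--supports stmt-Parity-11292`): the series term `(r+1)^D e^{−r} ≤ (2D)^D e^{1/2} e^{−r/2}`. [folklore] -/
theorem nair_pow_mul_exp_neg_le : ∀ (D : ℕ), 1 ≤ D → ∀ r : ℕ, ((r : ℝ) + 1) ^ D * Real.exp (-(r : ℝ)) ≤ (2 * (D : ℝ)) ^ D * Real.exp (1 / 2) * Real.exp (-((r : ℝ) / 2)) :=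
  fun _D hD1 r => pow_mul_exp_neg_le hD1 r

end

end Summit.Parity.BatemanHorn.Cruxes.SystemLSDRealSegment.BetaThinnedRootKernel.Nair
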